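import Literature.AlgebraicGeometry.Resolution.MarkedIdealsLemmas
import HarnessLib

/-!
# Crux `PatchingRelPerfect` (stmt-ResolutionOfSingularities-16161), chain w52 — R4 support «S-O»:
# the ORDER TOOLKIT (the thin glue the E-side targets of `ChainW52TargetsF2` consume)

[OURS · L1 W5.2 · rung tool] res-L1-w52-plan-1 g6 STEER 05:26:19Z (e) asked for five order
lemmas about `idealOrder` (`ord_x 𝔟 := max {i | 𝔟_x ⊆ 𝔪_xⁱ}`, `Literature…MarkedIdeals`).  Three
of them are ALREADY tree theorems and are only POINTED TO here (no restatement):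

* (ii) closedness of the order locus `{x | ν ≤ ord_x 𝔟}` — `isClosed_setOf_le_idealOrder`
  (regular excellent `X`, `𝔟 ≠ ⊥`; `Resolution/OrderSemicontinuity.lean`) and its pointwise half
  `idealOrder_le_of_specializes` / `stableUnderSpecialization_setOf_le_idealOrder`
  (`Resolution/OrderSemicontinuityPointwise.lean`, regular stalks suffice);
* (iii) order along a morphism / closed immersion — `idealOrder_le_idealOrder_comap`
  (`ord_{φ x'} I ≤ ord_{x'} (φ^* I)`, ANY `φ`; `Resolution/MarkedIdealsEtale.lean`) and the exact
  formula `le_idealOrder_comap_iff_of_isClosedImmersion` (`Resolution/ClosedImmersionIdealOrder.lean`);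
* (v, snc half) the order of a monomial ideal in an snc boundary is its weight —
  `le_idealOrder_monomialIdeal_iff` (`Resolution/MonomialMarkedIdeals.lean`), and for a principal
  stalk `(g)` of exact order `w` at a regular point `idealOrder_mul_of_span_singleton`
  (`Hironaka2017/Lib/MonomialPartBlowup.lean`); sums: `idealOrder_sup`
  (`Hironaka2017/Lib/PermissibleSeqInter.lean`).

PROVED here (the genuinely missing glue, every scheme, no hypothesis on `X`):

* `le_idealOrder_of_le_pow` — (i) the converse of `OrderPermissible`: `𝔟 ≤ C^ν` and `x ∈ V(C)`
  give `ν ≤ ord_x 𝔟`; `le_idealOrder_of_le_mul_pow` — the same for a format `𝔟 ≤ M · C^ν`;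
* `idealOrder_mul_of_not_mem_support_left/right` — (iv) `ord_x (M · K) = ord_x K` off `Supp M`;
* `idealOrder_lt_natCast_iff`, `idealOrder_le_one_iff`, `idealOrder_le_one_iff_exists` — (v) the
  reading of `ord_x 𝔟 < μ` / `ord_x 𝔟 ≤ 1` as `𝔟_x ⊄ 𝔪_x^μ` / `∃ f ∈ 𝔟_x, f ∉ 𝔪_x²` (the end
  condition of `WeightedCleanupSNC μ` and of `WeightTwoPrincipal₃`);
* `idealOrder_eq_zero_iff_not_mem_support`, `idealOrder_pos_iff_mem_support` — bookkeeping.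

Fact-free; nothing here is a statement of the manuscript under review.

## References

* E. Bierstone, D. Grigoriev, P. Milman, J. Włodarczyk, *Effective Hironaka resolution and its
  complexity*, Asian J. Math. 15 (2011), §3.1 p. 6 (order of an ideal), Def. 3.1.3 (1).
  [BierstoneGrigorievMilmanWlodarczyk2011]
-/

-- `Summit.<Summit>.<Sub>.Theorems` with `Sub = Summit` (single-conjunct summit, D-0017)
set_option linter.dupNamespace false

noncomputable section

open CategoryTheory AlgebraicGeometry TopologicalSpace IsLocalRing
open Literature.AlgebraicGeometry.Resolution

namespace Summit.ResolutionOfSingularities.ResolutionOfSingularities.Theorems.DepthTargets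

universe u

variable {X : Scheme.{u}}

/-! ## (i) Permissibility forces order: the converse of `OrderPermissible` -/

/-- **`𝔟 ≤ C^ν` forces `ν ≤ ord_x 𝔟` at every point of `V(C)`** (`C_x ⊆ 𝔪_x`, so
`𝔟_x ⊆ C_x^ν ⊆ 𝔪_x^ν`). [cite: BierstoneGrigorievMilmanWlodarczyk2011, §3.1 p. 6, Def. 3.1.3 (1)] -/
theorem le_idealOrder_of_le_pow {𝔟 C : X.IdealSheafData} {ν : ℕ} (h : 𝔟 ≤ C ^ ν) {x : X}
    (hx : x ∈ C.support) : (ν : ℕ∞) ≤ idealOrder 𝔟 x := by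
  rw [le_idealOrder_iff]
  calc stalkIdeal 𝔟 x ≤ stalkIdeal (C ^ ν) x := stalkIdeal_mono h x
    _ = stalkIdeal C x ^ ν := stalkIdeal_pow C ν x
    _ ≤ maximalIdeal (X.presheaf.stalk x) ^ ν :=
        Ideal.pow_right_mono ((mem_support_iff_stalkIdeal_le C x).mp hx) ν

/-- The same for a FORMAT `𝔟 ≤ M · C^ν` (e.g. a total transform `M · K` with `M` the exceptional
monomial): `ν ≤ ord_x 𝔟` on `V(C)`. [cite: BierstoneGrigorievMilmanWlodarczyk2011, §3.1 p. 6] -/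
theorem le_idealOrder_of_le_mul_pow {𝔟 M C : X.IdealSheafData} {ν : ℕ} (h : 𝔟 ≤ M * C ^ ν) {x : X}
    (hx : x ∈ C.support) : (ν : ℕ∞) ≤ idealOrder 𝔟 x :=
  le_idealOrder_of_le_pow (h.trans (fun _ => Ideal.mul_le_left : M * C ^ ν ≤ C ^ ν)) hx

/-! ## (iv) Invertible factors off their support do not change the order -/

/-- **`ord_x (M · K) = ord_x K` for `x ∉ Supp M`** (`M_x = 𝒪_{X,x}`). [folklore] -/
theorem idealOrder_mul_of_not_mem_support_left {M : X.IdealSheafData} (K : X.IdealSheafData) {x : X}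
    (hx : x ∉ M.support) : idealOrder (M * K) x = idealOrder K x := by
  have h : stalkIdeal (M * K) x = stalkIdeal K x := by
    rw [stalkIdeal_mul, stalkIdeal_eq_top_of_not_mem_support hx, Ideal.top_mul]
  refine le_antisymm (ENat.forall_natCast_le_iff_le.mp fun n hn => ?_)
    (ENat.forall_natCast_le_iff_le.mp fun n hn => ?_)
  · rw [le_idealOrder_iff] at hn ⊢
    rwa [h] at hn
  · rw [le_idealOrder_iff] at hn ⊢
    rwa [h]

/-- **`ord_x (K · M) = ord_x K` for `x ∉ Supp M`**. [folklore] -/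
theorem idealOrder_mul_of_not_mem_support_right (K : X.IdealSheafData) {M : X.IdealSheafData}
    {x : X} (hx : x ∉ M.support) : idealOrder (K * M) x = idealOrder K x := by
  rw [mul_comm, idealOrder_mul_of_not_mem_support_left K hx]

/-! ## (v) Reading small orders -/

/-- **`ord_x 𝔟 < n` iff `𝔟_x ⊄ 𝔪_xⁿ`** (`n : ℕ`). [cite: BierstoneGrigorievMilmanWlodarczyk2011, §3.1 p. 6] -/
theorem idealOrder_lt_natCast_iff (𝔟 : X.IdealSheafData) (x : X) (n : ℕ) :
    idealOrder 𝔟 x < (n : ℕ∞) ↔ ¬ stalkIdeal 𝔟 x ≤ maximalIdeal (X.presheaf.stalk x) ^ n := by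
  rw [← not_le, le_idealOrder_iff]

/-- **`ord_x 𝔟 ≤ 1` iff `𝔟_x ⊄ 𝔪_x²`** — the end condition of the weight-two trace theorem
`WeightTwoPrincipal₃`. [cite: BierstoneGrigorievMilmanWlodarczyk2011, §3.1 p. 6] -/
theorem idealOrder_le_one_iff (𝔟 : X.IdealSheafData) (x : X) :
    idealOrder 𝔟 x ≤ 1 ↔ ¬ stalkIdeal 𝔟 x ≤ maximalIdeal (X.presheaf.stalk x) ^ 2 := by
  rw [← idealOrder_lt_natCast_iff, show ((2 : ℕ) : ℕ∞) = 1 + 1 from rfl,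
    ENat.lt_add_one_iff ENat.one_ne_top]

/-- `ord_x 𝔟 ≤ 1` iff some germ of `𝔟` at `x` is NOT in `𝔪_x²` (a unit or a regular parameter).
[cite: BierstoneGrigorievMilmanWlodarczyk2011, §3.1 p. 6] -/
theorem idealOrder_le_one_iff_exists (𝔟 : X.IdealSheafData) (x : X) :
    idealOrder 𝔟 x ≤ 1 ↔
      ∃ f ∈ stalkIdeal 𝔟 x, f ∉ maximalIdeal (X.presheaf.stalk x) ^ 2 := by
  rw [idealOrder_le_one_iff, SetLike.not_le_iff_exists]

/-- `ord_x 𝔟 = 0` iff `x ∉ Supp 𝔟`. [folklore] -/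
theorem idealOrder_eq_zero_iff_not_mem_support (𝔟 : X.IdealSheafData) (x : X) :
    idealOrder 𝔟 x = 0 ↔ x ∉ 𝔟.support := by
  rw [← one_le_idealOrder_iff, not_le, Order.lt_one_iff]

/-- `0 < ord_x 𝔟` iff `x ∈ Supp 𝔟`. [folklore] -/
theorem idealOrder_pos_iff_mem_support (𝔟 : X.IdealSheafData) (x : X) :
    0 < idealOrder 𝔟 x ↔ x ∈ 𝔟.support := by
  rw [← one_le_idealOrder_iff, Order.one_le_iff_pos]

end Summit.ResolutionOfSingularities.ResolutionOfSingularities.Theorems.DepthTargets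

end
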